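import Mathlib

/-!
# Stub `stub_tangencySets` of the crux `LevelOneGL2Designs` (stmt-MatrixMultiplication-14080) —
wall-breaker axis 10/12 (Hermitian unital constructions), part 1: reduction to tangency sets

The stub asks for strong representative systems (SRS) of the affine plane over `ZMod p`:
flags `(u_f, v_f)` with `u_f ⬝ᵥ v_{f'} = 1 ↔ f = f'`, of size `c · p^{3/2}` for unboundedly many
PRIMES `p`.  This file proves, over any finite field `F`, that the stub's normal form is
equivalent (up to a factor `1 - 1/|F|` in size) to the classical object of finite geometry:

* `srs_of_tangencySet`: an affine TANGENCY SET `V ⊆ F²` (every point `v` carries a line through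
  it, in arbitrary position, meeting `V` only in `v`) yields an SRS in the stub's dot-product
  normal form of size `≥ |V|(1 - 1/|F|)` — translate the origin to a point lying on at most
  `|V|/|F|` of the tangent lines (`exists_origin`, averaging over the `|F|²` points using
  `card_line`), drop those points, rescale the normal vectors;
* `tangencySet_of_srs`: conversely the points of an SRS form a tangency set of the same size;
* `stub_tangencySets_of_affineTangencySets` / `affineTangencySets_of_stub`: the two directions in
  the stub's exact quantifier shape over `ZMod p` (constant halved one way, kept the other).

So `stub_tangencySets` is EQUIVALENT to "tangency sets of size `c·p^{3/2}` in `AG(2,p)` for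
unboundedly many primes `p`" — the prime-order case of the Illés–Szőnyi–Wettl extremal problem
(at most `q√q + 1` points in a plane of order `q`, equality iff the points form a unital); the
companion file `…StubTangencySetsHermitian.lean` proves the square-order case via the Hermitian
curve.  Nothing here is specific to the crux; no new definitions.
-/

-- justification: the tree path `MatrixMultiplication/MatrixMultiplication` (summit = problem) makes every
-- declaration name contain a duplicated namespace segment, which this linter would flag.
set_option linter.dupNamespace false

noncomputable section

open scoped BigOperators
open Finset Matrix Polynomial

namespace Summit.MatrixMultiplication.MatrixMultiplication.Theorems.LevelOneGL2Designs.FlagLine.TangencyHermitian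

/-! ## Reduction: affine tangency sets give strong representative systems -/

section Reduction

variable {F : Type*} [Field F] [Fintype F] [DecidableEq F]

/-- An affine line `{O : u ⬝ᵥ O = t}` of the plane `F²` (`u ≠ 0`) has exactly `|F|` points.
[folklore] -/
theorem card_line (u : Fin 2 → F) (hu : u ≠ 0) (t : F) :
    (univ.filter fun O : Fin 2 → F => u ⬝ᵥ O = t).card = Fintype.card F := by
  have hu' : u 0 ≠ 0 ∨ u 1 ≠ 0 := by
    by_contra h
    push Not at h
    apply hu
    funext i
    fin_cases i
    · exact h.1
    · exact h.2
  rcases hu' with h0 | h1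
  · -- parametrise by the second coordinate
    let φ : F → (Fin 2 → F) := fun y => ![(t - u 1 * y) / u 0, y]
    have hφ : Function.Injective φ := by
      intro y y' h
      have := congrFun h 1
      simpa [φ] using this
    have hset : (univ.filter fun O : Fin 2 → F => u ⬝ᵥ O = t) = univ.image φ := by
      ext O
      simp only [mem_filter, mem_univ, true_and, mem_image]
      constructor
      · intro hO
        refine ⟨O 1, ?_⟩
        rw [vec2_dotProduct] at hO
        funext i
        fin_cases i
        · simp only [φ, Fin.zero_eta, Matrix.cons_val_zero]
          rw [← hO]
          field_simp
          ring
        · simp [φ]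
      · rintro ⟨y, rfl⟩
        simp only [φ, vec2_dotProduct, Matrix.cons_val_zero, Matrix.cons_val_one,
          Matrix.cons_val_fin_one]
        field_simp
        ring
    rw [hset, card_image_of_injective _ hφ, card_univ]
  · -- parametrise by the first coordinate
    let φ : F → (Fin 2 → F) := fun x => ![x, (t - u 0 * x) / u 1]
    have hφ : Function.Injective φ := by
      intro x x' h
      have := congrFun h 0
      simpa [φ] using this
    have hset : (univ.filter fun O : Fin 2 → F => u ⬝ᵥ O = t) = univ.image φ := by
      ext O
      simp only [mem_filter, mem_univ, true_and, mem_image]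
      constructor
      · intro hO
        refine ⟨O 0, ?_⟩
        rw [vec2_dotProduct] at hO
        funext i
        fin_cases i
        · simp [φ]
        · simp only [φ, Fin.mk_one, Matrix.cons_val_one, Matrix.cons_val_fin_one]
          rw [← hO]
          field_simp
          ring
      · rintro ⟨x, rfl⟩
        simp only [φ, vec2_dotProduct, Matrix.cons_val_zero, Matrix.cons_val_one,
          Matrix.cons_val_fin_one]
        field_simp
        ring
    rw [hset, card_image_of_injective _ hφ, card_univ]

/-- **Averaging over origins.**  Given points `v ∈ V` with tangent lines
`{w : u v ⬝ᵥ w = u v ⬝ᵥ v}` (`u v ≠ 0`), some point `O` of the plane lies on at most `|V| / |F|`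
of these lines: the total number of incidences is `|V| · |F|` (`card_line`) spread over `|F|²`
points. [folklore] -/
theorem exists_origin (V : Finset (Fin 2 → F)) (u : (Fin 2 → F) → (Fin 2 → F))
    (hu0 : ∀ v ∈ V, u v ≠ 0) :
    ∃ O : Fin 2 → F,
      (V.filter fun v => u v ⬝ᵥ O = u v ⬝ᵥ v).card * Fintype.card F ≤ V.card := by
  have hsum : ∑ O : Fin 2 → F, (V.filter fun v => u v ⬝ᵥ O = u v ⬝ᵥ v).card
      = V.card * Fintype.card F := by
    calc ∑ O : Fin 2 → F, (V.filter fun v => u v ⬝ᵥ O = u v ⬝ᵥ v).card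
        = ∑ O : Fin 2 → F, ∑ v ∈ V, (if u v ⬝ᵥ O = u v ⬝ᵥ v then 1 else 0) := by
          simp_rw [Finset.card_filter]
      _ = ∑ v ∈ V, ∑ O : Fin 2 → F, (if u v ⬝ᵥ O = u v ⬝ᵥ v then 1 else 0) :=
          Finset.sum_comm
      _ = ∑ v ∈ V, (univ.filter fun O : Fin 2 → F => u v ⬝ᵥ O = u v ⬝ᵥ v).card := by
          simp_rw [Finset.card_filter]
      _ = ∑ v ∈ V, Fintype.card F :=
          Finset.sum_congr rfl fun v hv => card_line (u v) (hu0 v hv) _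
      _ = V.card * Fintype.card F := by rw [Finset.sum_const, smul_eq_mul]
  by_contra h
  push Not at h
  have hlt : ∑ _O : Fin 2 → F, V.card
      < ∑ O : Fin 2 → F, (V.filter fun v => u v ⬝ᵥ O = u v ⬝ᵥ v).card * Fintype.card F :=
    Finset.sum_lt_sum_of_nonempty univ_nonempty fun O _ => h O
  rw [Finset.sum_const, smul_eq_mul, ← Finset.sum_mul, hsum, card_univ, Fintype.card_fun,
    Fintype.card_fin] at hlt
  exact absurd hlt (not_lt.2 (le_of_eq (by ring)))

/-- **Tangency sets give strong representative systems** (the reduction of the stub to the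
classical object).  Let `V ⊆ F²` be a finite set of points and suppose every `v ∈ V` carries a
line through it — with normal vector `u v ≠ 0`, in arbitrary position — meeting `V` only in
`v`.  Then there is a set `S` of flags in the stub's normal form (`f.1 ⬝ᵥ f'.2 = 1 ↔ f = f'`)
with `|S| · |F| ≥ |V| · |F| - |V|`, i.e. `|S| ≥ |V| (1 - 1/|F|)`.  Proof: move the origin to a
point `O` on at most `|V|/|F|` tangent lines (`exists_origin`), drop those points, and rescale
each remaining normal vector so that its line reads `u ⬝ᵥ x = 1`. [folklore] -/
theorem srs_of_tangencySet (V : Finset (Fin 2 → F)) (u : (Fin 2 → F) → (Fin 2 → F))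
    (hu0 : ∀ v ∈ V, u v ≠ 0) (hu : ∀ v ∈ V, ∀ w ∈ V, u v ⬝ᵥ w = u v ⬝ᵥ v → w = v) :
    ∃ S : Finset ((Fin 2 → F) × (Fin 2 → F)),
      V.card * Fintype.card F ≤ S.card * Fintype.card F + V.card ∧
      ∀ f ∈ S, ∀ f' ∈ S, (f.1 ⬝ᵥ f'.2 = 1 ↔ f = f') := by
  obtain ⟨O, hO⟩ := exists_origin V u hu0
  set bad := V.filter fun v => u v ⬝ᵥ O = u v ⬝ᵥ v with hbad
  set good := V.filter fun v => ¬ (u v ⬝ᵥ O = u v ⬝ᵥ v) with hgood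
  let Φ : (Fin 2 → F) → (Fin 2 → F) × (Fin 2 → F) :=
    fun v => ((u v ⬝ᵥ (v - O))⁻¹ • u v, v - O)
  have hΦ : Function.Injective Φ := fun v w h => sub_left_injective (congrArg Prod.snd h)
  refine ⟨good.image Φ, ?_, ?_⟩
  · rw [Finset.card_image_of_injective _ hΦ]
    have hsplit : bad.card + good.card = V.card :=
      Finset.card_filter_add_card_filter_not _
    rw [← hsplit]
    nlinarith [hO, Nat.zero_le (good.card * Fintype.card F)]
  · simp only [Finset.mem_image]
    rintro f ⟨v, hv, rfl⟩ f' ⟨w, hw, rfl⟩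
    rw [hgood, Finset.mem_filter] at hv hw
    have hne : u v ⬝ᵥ (v - O) ≠ 0 := by
      rw [dotProduct_sub, sub_ne_zero]
      exact fun h => hv.2 h.symm
    rw [hΦ.eq_iff]
    simp only [Φ, smul_dotProduct, smul_eq_mul]
    constructor
    · intro h
      rw [inv_mul_eq_one₀ hne, dotProduct_sub, dotProduct_sub, sub_left_inj] at h
      exact (hu v hv.1 w hw.1 h.symm).symm
    · rintro rfl
      exact inv_mul_cancel₀ hne

omit [Fintype F] in
/-- Converse of `srs_of_tangencySet`: the points `v_f` of a strong representative system form an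
affine tangency set of the same size (the line `u_f ⬝ᵥ x = 1` is tangent at `v_f`). [folklore] -/
theorem tangencySet_of_srs (S : Finset ((Fin 2 → F) × (Fin 2 → F)))
    (hS : ∀ f ∈ S, ∀ f' ∈ S, (f.1 ⬝ᵥ f'.2 = 1 ↔ f = f')) :
    ∃ V : Finset (Fin 2 → F), V.card = S.card ∧
      ∀ v ∈ V, ∃ u : Fin 2 → F, u ≠ 0 ∧ ∀ w ∈ V, u ⬝ᵥ w = u ⬝ᵥ v → w = v := by
  have hinj : Set.InjOn Prod.snd (S : Set ((Fin 2 → F) × (Fin 2 → F))) := by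
    intro f hf f' hf' h
    have h1 : f.1 ⬝ᵥ f.2 = 1 := (hS f hf f hf).2 rfl
    exact (hS f hf f' hf').1 (by simpa [← h] using h1)
  refine ⟨S.image Prod.snd, Finset.card_image_of_injOn hinj, ?_⟩
  simp only [Finset.mem_image]
  rintro v ⟨f, hf, rfl⟩
  have h1 : f.1 ⬝ᵥ f.2 = 1 := (hS f hf f hf).2 rfl
  refine ⟨f.1, ?_, ?_⟩
  · rintro h0
    rw [h0, zero_dotProduct] at h1
    exact zero_ne_one h1
  · rintro w ⟨f', hf', rfl⟩ h
    rw [h1] at h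
    rw [(hS f hf f' hf').1 h]

/-- **The stub follows from affine tangency sets over prime fields** (reduction in the stub's
exact quantifier shape, constant halved): if for unboundedly many primes `p` there are tangency
sets of size `c · p^{3/2}` in `AG(2,p)`, then `stub_tangencySets` holds with constant `c/2`
(`srs_of_tangencySet` loses at most the `≤ |V|/p ≤ |V|/2` points whose tangent passes through
the new origin). [folklore] -/
theorem stub_tangencySets_of_affineTangencySets
    (h : ∃ c : ℝ, 0 < c ∧ ∀ p₀ : ℕ, ∃ (p : ℕ) (_ : Fact p.Prime), p₀ ≤ p ∧
      ∃ V : Finset (Fin 2 → ZMod p), c * (p : ℝ) ^ (3 / 2 : ℝ) ≤ V.card ∧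
        ∀ v ∈ V, ∃ u : Fin 2 → ZMod p, u ≠ 0 ∧ ∀ w ∈ V, u ⬝ᵥ w = u ⬝ᵥ v → w = v) :
    ∃ c : ℝ, 0 < c ∧ ∀ p₀ : ℕ, ∃ (p : ℕ) (_ : Fact p.Prime), p₀ ≤ p ∧
      ∃ S : Finset ((Fin 2 → ZMod p) × (Fin 2 → ZMod p)),
        c * (p : ℝ) ^ (3 / 2 : ℝ) ≤ S.card ∧
        ∀ f ∈ S, ∀ f' ∈ S, (dotProduct f.1 f'.2 = 1 ↔ f = f') := by
  obtain ⟨c, hc, hfam⟩ := h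
  refine ⟨c / 2, by positivity, fun p₀ => ?_⟩
  obtain ⟨p, hp, hp₀, V, hV, htan⟩ := hfam p₀
  choose! u hu0 hu using htan
  obtain ⟨S, hS, hsrs⟩ := srs_of_tangencySet V u hu0 hu
  refine ⟨p, hp, hp₀, S, ?_, hsrs⟩
  rw [ZMod.card] at hS
  have hp2 : 2 ≤ p := hp.out.two_le
  have hVS : V.card ≤ 2 * S.card := by
    by_contra hcon
    push Not at hcon
    nlinarith [hS, hcon, hp2, Nat.zero_le (S.card * (p - 2)), Nat.sub_add_cancel hp2]
  have hVS' : (V.card : ℝ) ≤ 2 * S.card := by exact_mod_cast hVS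
  have hpow : 0 ≤ (p : ℝ) ^ (3 / 2 : ℝ) := by positivity
  calc c / 2 * (p : ℝ) ^ (3 / 2 : ℝ) = (c * (p : ℝ) ^ (3 / 2 : ℝ)) / 2 := by ring
    _ ≤ (V.card : ℝ) / 2 := by gcongr
    _ ≤ S.card := by linarith

/-- The converse reduction: `stub_tangencySets` gives affine tangency sets of the same size over
the same primes (`tangencySet_of_srs`), so the stub is equivalent to the prime-order case of the
Illés–Szőnyi–Wettl extremal problem. [folklore] -/
theorem affineTangencySets_of_stub
    (h : ∃ c : ℝ, 0 < c ∧ ∀ p₀ : ℕ, ∃ (p : ℕ) (_ : Fact p.Prime), p₀ ≤ p ∧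
      ∃ S : Finset ((Fin 2 → ZMod p) × (Fin 2 → ZMod p)),
        c * (p : ℝ) ^ (3 / 2 : ℝ) ≤ S.card ∧
        ∀ f ∈ S, ∀ f' ∈ S, (dotProduct f.1 f'.2 = 1 ↔ f = f')) :
    ∃ c : ℝ, 0 < c ∧ ∀ p₀ : ℕ, ∃ (p : ℕ) (_ : Fact p.Prime), p₀ ≤ p ∧
      ∃ V : Finset (Fin 2 → ZMod p), c * (p : ℝ) ^ (3 / 2 : ℝ) ≤ V.card ∧
        ∀ v ∈ V, ∃ u : Fin 2 → ZMod p, u ≠ 0 ∧ ∀ w ∈ V, u ⬝ᵥ w = u ⬝ᵥ v → w = v := by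
  obtain ⟨c, hc, hfam⟩ := h
  refine ⟨c, hc, fun p₀ => ?_⟩
  obtain ⟨p, hp, hp₀, S, hS, hsrs⟩ := hfam p₀
  obtain ⟨V, hV, htan⟩ := tangencySet_of_srs S hsrs
  exact ⟨p, hp, hp₀, V, by rw [hV]; exact hS, htan⟩

end Reduction


section Packaging

/-- **The stub is equivalent to the prime-order tangency-set problem** (packaging of the two
reductions above): `stub_tangencySets` holds iff for some `c > 0` and unboundedly many primes `p`
there is a point set `V ⊆ (ZMod p)²` of size `≥ c·p^{3/2}` with a tangent line (in arbitrary
position) at each of its points — i.e. iff `limsup_p IM(2,p) / p^{3/2} > 0` over primes, `IM` the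
induced point–line matching number of Hunter–Pohoata–Verstraëte–Zhang (arXiv:2601.19879, Def. 1.1),
whose Conjecture 10.2 (`IM(2,p) ≤ p^{3/2-c}` for all large primes) asserts the right-hand side is
false.  (`stub_tangencySets_of_affineTangencySets` halves the constant, `affineTangencySets_of_stub`
keeps it.) [folklore] -/
theorem stub_tangencySets_iff_affineTangencySets :
    (∃ c : ℝ, 0 < c ∧ ∀ p₀ : ℕ, ∃ (p : ℕ) (_ : Fact p.Prime), p₀ ≤ p ∧
      ∃ S : Finset ((Fin 2 → ZMod p) × (Fin 2 → ZMod p)),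
        c * (p : ℝ) ^ (3 / 2 : ℝ) ≤ S.card ∧
        ∀ f ∈ S, ∀ f' ∈ S, (dotProduct f.1 f'.2 = 1 ↔ f = f')) ↔
    (∃ c : ℝ, 0 < c ∧ ∀ p₀ : ℕ, ∃ (p : ℕ) (_ : Fact p.Prime), p₀ ≤ p ∧
      ∃ V : Finset (Fin 2 → ZMod p), c * (p : ℝ) ^ (3 / 2 : ℝ) ≤ V.card ∧
        ∀ v ∈ V, ∃ u : Fin 2 → ZMod p, u ≠ 0 ∧ ∀ w ∈ V, u ⬝ᵥ w = u ⬝ᵥ v → w = v) :=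
  ⟨affineTangencySets_of_stub, stub_tangencySets_of_affineTangencySets⟩

end Packaging

end Summit.MatrixMultiplication.MatrixMultiplication.Theorems.LevelOneGL2Designs.FlagLine.TangencyHermitian
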